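import Summits.ResolutionOfSingularities.ResolutionOfSingularities.Theorems.UniformComplexityCampaignW82TwistExponentRegularAlgebra
import Summits.ResolutionOfSingularities.ResolutionOfSingularities.Theorems.UniformComplexityCampaignW82TwistExponentUnbounded
import Summits.ResolutionOfSingularities.ResolutionOfSingularities.Theorems.UniversalCellsCampaignW82RegularFormProofs
import Mathlib.FieldTheory.IsAlgClosed.AlgebraicClosure
import HarnessLib

/-!
# [OURS · L1 W8.2] No bounded Frobenius-twist exponent EVEN AMONG REGULAR varieties: the witness curves are regular

Cell `res-hironaka` (run/shared/lean/pub/res-hironaka/), LADDER-RESOLUTION rung L (RESCUE), slot W8.2 of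
plan/RESCUE-SEED.md («PRIME-FIELD / UNIVERSALITY TRANSFER instead of descent»), door 2 = route
`UniformComplexity`, host item `PrimeModelTransfer` (stmt-ResolutionOfSingularities-8933); prover
res-L1-s82-pv-2 (gen 4). THESES-FREE module (imports the gen-4 algebra sibling `…TwistExponentRegularAlgebra`
(`isRegular_twistCurve_one`, `isIntegral_twistCurve_one`, `irreducible_X_pow_sub_C_ratFuncX_of_pos`), the gen-3
sibling `…TwistExponentUnbounded` (`no_smooth_model_frobeniusTwist_of_le`, `altPrime`), res-L1-s82-pv-1's
`…RegularFormProofs` (`frobeniusTwistStepRegularAt_of_le_one`), Mathlib, `HarnessLib`).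

[OURS · L1 W8.2] replaces the role of no printed item; NOT a statement of H. Hironaka's manuscript. This is the
REGULAR v2 of the gen-3 negative rung `frobeniusTwist_exponent_unbounded` / `not_exists_uniform_frobeniusTwist_exponent`
(Theorems/UniformComplexityCampaignW82TwistExponentUnbounded.lean): there the witness `X₀ : y^q = x^{p^{e₀+1}} − t`
over `M(t)` was only recorded as separated, of finite type, of dimension `≤ 1` and integral over the perfect
closure. Here we prove that it is moreover an INTEGRAL, REGULAR scheme (`isIntegral_witness`, `isRegular_witness`),
so the rung bites on the hypothesis block of the lane-signed REGULAR normal form of the slot's residual,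
`CampaignW82.FrobeniusTwistStepRegularAt p M n` (p485672; TFAE with the perfection / smooth-twist / Frobenius-twist
steps, `residual_normalForms_tfae` p486090), binder for binder:

* `frobeniusTwist_exponent_unbounded_regular p M e₀`: for EVERY prime `p`, EVERY field `M` of characteristic `p`
  (door 1: perfect `M`; door 2: algebraically closed `M`) and every `e₀` there is a REGULAR INTEGRAL curve
  `X₀ ⟶ Spec M(t)`, integral over the perfect closure, with a smooth proper birational model of SOME Frobenius
  twist but of NO twist of level `e ≤ e₀`;
* `not_exists_uniform_frobeniusTwist_exponent_regular p M`: so «`∃ e ≤ E`» in place of «`∃ e`» in the conclusion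
  of `FrobeniusTwistStepRegularAt p M 1` is false for every `E`;
* by grade (§17): the bounded conclusion fails at every `n ≥ 1` (`not_boundedExponent_conclusion`); the bounded
  STEP (hypothesis ⇒ bounded conclusion) holds iff its hypothesis fails (`boundedFrobeniusTwistStepRegularAt_iff_not_hyp`),
  so it is FALSE at `n = 1` unconditionally while the genuine step is TRUE there
  (`frobeniusTwistStepRegularAt_one_and_not_bounded`), false for `n ≤ 3` given F-02
  (`not_boundedFrobeniusTwistStepRegularAt_of_le_three`), and at `⊤` equivalent to «no resolution over `M(t)`»
  (`boundedFrobeniusTwistStepRegularAt_top_iff`), refuted by `ResolutionInChar p`; door-2 reading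
  `not_forall_isAlgClosed_boundedExponent_conclusion_one`.

Reading for the slot: in the residual (open for `n ≥ 4`) the Frobenius level `e` must depend on `X₀` EVEN AFTER
`X₀` HAS BEEN RESOLVED — regularity of `X₀` (which the residual's hypothesis supplies for free,
`frobeniusTwistStepAt_iff_regular`) buys no control of `e`; this joins res-L1-s82-pv-1's «`e = 0` is insufficient
for regular `X₀`» (`not_smoothModelStepRegularAt_one`, Kollár's curve) and gen 3's «`e` unbounded».

The algebra is in the sibling Theorems/UniformComplexityCampaignW82TwistExponentRegularAlgebra.lean (any field `K`,
`P ≥ 1`, `q` prime with `q ∤ P`, `q ≠ 0` in `K`, `X^P − t` irreducible: `isRegularRing_twistRing_one` — at the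
inseparable point `Q_1 = (y)` a Noetherian local domain with principal maximal ideal, elsewhere
`∂f/∂X₀ = qX₀^{q−1} ∉ 𝔮` and Matsumura 14.2; `irreducible_X_pow_sub_C_ratFuncX_of_pos` by Eisenstein at `(t)`);
here (§15) it is specialised to `K = M(t)`, `P = p^m`, `q = altPrime p` (`isRegular_witness`, `isIntegral_witness`).

HONEST FRAMING. OURS bookkeeping about an OURS statement; NOT a statement of H. Hironaka's 2017 manuscript
([Hironaka2017]); nothing is attributed to its author. It says nothing about the open grades `n ≥ 4` beyond
«`e` is not uniform, even on regular `X₀`»; AI work, weaker than expert review. No `sorry`, no new axioms.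

## References (vocabulary and locators only)
* J. Kollár, *Lectures on Resolution of Singularities* (2007), 1.19 («the maximal ideal … is generated by `y`
  alone»). [Kollar2007]
* Q. Liu, *Algebraic Geometry and Arithmetic Curves* (2002), Ex. 7.3.15. [Liu2002]
* H. Matsumura, *Commutative Ring Theory* (1986), Thm. 14.2. [Matsumura1987]
* L/res-L1-s82-pv-2/NOTES.md (gen 4); Cruxes/PrimeFieldToPerfect/KERNEL-c3.md §1.
-/

noncomputable section

set_option linter.dupNamespace false -- mandated namespace of this single-conjunct summit

open Polynomial IsLocalRing
open _root_.CategoryTheory _root_.CategoryTheory.Limits _root_.AlgebraicGeometry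

namespace Summit.ResolutionOfSingularities.ResolutionOfSingularities.Theorems.CampaignW82.TwistExponent

open Literature.AlgebraicGeometry.Resolution

/-! ## §15 The witness over `K = M(t)`: `X₀ = C_1` with `P = p^m`, `q = altPrime p` -/

section Main

variable (p : ℕ) [hp : Fact p.Prime] (M : Type) [Field M] [CharP M p]

/-- `altPrime p ≠ 0` in a field of characteristic `p` (`altPrime p` is a prime `≠ p`). [folklore] -/
theorem altPrime_cast_ne_zero (K : Type) [Field K] [CharP K p] : (altPrime p : K) ≠ 0 := fun h =>
  altPrime_ne hp.out ((Nat.prime_dvd_prime_iff_eq hp.out (altPrime_prime p)).mp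
    ((CharP.cast_eq_zero_iff K p (altPrime p)).mp h)).symm

/-- **The witness `X₀ : y^q = x^{p^m} − t` over `M(t)` (`q = altPrime p`) is a REGULAR scheme** — for every
constant field `M` of characteristic `p` and every `m`: `X^{p^m} − t` is irreducible over `M(t)` (Eisenstein),
`q ∤ p^m`, `q ≠ 0` in `M(t)`. At the inseparable point `(y = 0, x^{p^m} = t)` the maximal ideal is `(y)`.
[folklore] -/
theorem isRegular_witness (m : ℕ) :
    Scheme.IsRegular (twistCurve (RatFunc M) (p ^ m) RatFunc.X (altPrime p) 1) :=
  haveI : Fact (altPrime p).Prime := ⟨altPrime_prime p⟩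
  isRegular_twistCurve_one (RatFunc M) (p ^ m) RatFunc.X (altPrime p) (pow_pos hp.out.pos m)
    (not_altPrime_dvd hp.out m) (altPrime_cast_ne_zero p (RatFunc M))
    (irreducible_X_pow_sub_C_ratFuncX_of_pos M (pow_pos hp.out.pos m))

omit [CharP M p] in
/-- **The witness is an integral scheme.** [folklore] -/
theorem isIntegral_witness (m : ℕ) :
    IsIntegral (twistCurve (RatFunc M) (p ^ m) RatFunc.X (altPrime p) 1) :=
  haveI : Fact (altPrime p).Prime := ⟨altPrime_prime p⟩
  isIntegral_twistCurve_one (RatFunc M) (p ^ m) RatFunc.X (altPrime p) (pow_pos hp.out.pos m)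
    (not_altPrime_dvd hp.out m)

/-! ## §16 The rung for REGULAR varieties: no bound on the Frobenius-twist exponent -/

/-- **[OURS · L1 W8.2] THE EXPONENT OF THE FROBENIUS-TWIST NORMAL FORM IS UNBOUNDED ALREADY AMONG REGULAR
INTEGRAL CURVES over `M(t)`, for EVERY constant field `M` of characteristic `p`** (door 1: `M` perfect; door 2:
`M` algebraically closed; and all other `M`). For every `e₀` there is a separated finite-type
`f₀ : X₀ ⟶ Spec M(t)` with `dim X₀ ≤ 1`, `X₀` INTEGRAL and REGULAR (`Scheme.IsRegular`), integral over the perfect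
closure — namely `X₀ : y^q = x^{p^{e₀+1}} − t`, `q = altPrime p` — which HAS a smooth proper birational model of
some Frobenius twist (`CampaignW82.HasSmoothFrobeniusTwistModel`; level `e₀ + 1` works) but NO level `e ≤ e₀`
does (`no_smooth_model_frobeniusTwist_of_le`, res-L1-s82-pv-2 gen 3). This is the gen-3 rung
`frobeniusTwist_exponent_unbounded` with the two extra conjuncts `IsIntegral X₀ ∧ Scheme.IsRegular X₀`, so that it
bites on the hypothesis block of the lane-signed REGULAR normal form `CampaignW82.FrobeniusTwistStepRegularAt p M n`
verbatim: resolving `X₀` first cannot lower the exponent. Replaces the role of no printed item; NOT a statement of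
H. Hironaka's manuscript. [folklore] -/
theorem frobeniusTwist_exponent_unbounded_regular (e₀ : ℕ) :
    ∃ (X₀ : Scheme.{0}) (f₀ : X₀ ⟶ Spec (.of (RatFunc M))),
      IsSeparated f₀ ∧ LocallyOfFiniteType f₀ ∧ QuasiCompact f₀ ∧ topologicalKrullDim X₀ ≤ 1 ∧
      IntegralOverPerfectClosure (RatFunc M) f₀ ∧ IsIntegral X₀ ∧ Scheme.IsRegular X₀ ∧
      HasSmoothFrobeniusTwistModel p (RatFunc M) f₀ ∧
      ∀ e ≤ e₀, ∀ (Y : Scheme.{0})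
        (π : Y ⟶ pullback f₀ (Spec.map (CommRingCat.ofHom (iterateFrobenius (RatFunc M) p e)))),
        IsProper π → IsBirational π →
          ¬ Smooth (π ≫ pullback.snd f₀ (Spec.map (CommRingCat.ofHom (iterateFrobenius (RatFunc M) p e)))) := by
  let q := altPrime p
  haveI hq : Fact q.Prime := ⟨altPrime_prime p⟩
  have hqp : q ≠ p := altPrime_ne hp.out
  let f₀ := twistCurveTo (RatFunc M) (p ^ (e₀ + 1)) RatFunc.X q 1
  haveI : LocallyOfFiniteType f₀ := by
    rw [HasRingHomProperty.Spec_iff (P := @LocallyOfFiniteType), CommRingCat.hom_ofHom,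
      RingHom.finiteType_algebraMap]
    infer_instance
  have hd : topologicalKrullDim ↥(twistCurve (RatFunc M) (p ^ (e₀ + 1)) RatFunc.X q 1) ≤ 1 :=
    topologicalKrullDim_twistCurve_le_one
      (prime_twistPoly' (pow_pos hp.out.pos _) (not_altPrime_dvd hp.out _)
        (fun h => hq.out.ne_one (Nat.dvd_one.mp h))).ne_zero
  have hint : IntegralOverPerfectClosure (RatFunc M) f₀ :=
    integralOverPerfectClosure_twistCurve (RatFunc M) p RatFunc.X q hqp (e₀ + 1)
  refine ⟨twistCurve (RatFunc M) (p ^ (e₀ + 1)) RatFunc.X q 1, f₀, inferInstance, inferInstance,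
    inferInstance, hd, hint, isIntegral_witness p M (e₀ + 1), isRegular_witness p M (e₀ + 1),
    hasSmoothFrobeniusTwistModel_of_dim_le_one p (RatFunc M) f₀ hd hint, ?_⟩
  intro e he Y π hP hB hS
  exact no_smooth_model_frobeniusTwist_of_le p M q hqp e₀ e he Y π hB

/-- **[OURS · L1 W8.2] Hence NO UNIFORM EXPONENT EVEN FOR REGULAR `X₀`: the bounded-exponent strengthening
(«`∃ e ≤ E`» in place of «`∃ e`») of the conclusion of the REGULAR normal form
`CampaignW82.FrobeniusTwistStepRegularAt p M 1` is FALSE for every `E`, every prime `p` and every constant field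
`M` of characteristic `p`.** [folklore] -/
theorem not_exists_uniform_frobeniusTwist_exponent_regular :
    ¬ ∃ E : ℕ, ∀ (X₀ : Scheme.{0}) (f₀ : X₀ ⟶ Spec (.of (RatFunc M))),
      IsSeparated f₀ → LocallyOfFiniteType f₀ → QuasiCompact f₀ → topologicalKrullDim X₀ ≤ 1 →
        IntegralOverPerfectClosure (RatFunc M) f₀ → Scheme.IsRegular X₀ →
        ∃ e ≤ E, ∃ (Y : Scheme.{0})
          (π : Y ⟶ pullback f₀ (Spec.map (CommRingCat.ofHom (iterateFrobenius (RatFunc M) p e)))),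
          IsProper π ∧ IsBirational π ∧
            Smooth (π ≫ pullback.snd f₀ (Spec.map (CommRingCat.ofHom (iterateFrobenius (RatFunc M) p e)))) := by
  rintro ⟨E, hE⟩
  obtain ⟨X₀, f₀, hs, hl, hqc, hd, hint, -, hreg, -, hneg⟩ := frobeniusTwist_exponent_unbounded_regular p M E
  obtain ⟨e, he, Y, π, hP, hB, hS⟩ := hE X₀ f₀ hs hl hqc hd hint hreg
  exact hneg e he Y π hP hB hS

/-! ## §17 The bounded-exponent layer by grade: it fails wherever its hypothesis holds -/

/-- **The conclusion block of the regular Frobenius-twist step WITH A BOUND `e ≤ E` on the exponent fails over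
`M(t)` in every grade `n ≥ 1`**, for every `E` and every field `M` of characteristic `p` (the witness is a
regular curve). [folklore] -/
theorem not_boundedExponent_conclusion {n : WithBot ℕ∞} (hn : 1 ≤ n) (E : ℕ) :
    ¬ ∀ (X₀ : Scheme.{0}) (f₀ : X₀ ⟶ Spec (.of (RatFunc M))),
      IsSeparated f₀ → LocallyOfFiniteType f₀ → QuasiCompact f₀ → topologicalKrullDim X₀ ≤ n →
        IntegralOverPerfectClosure (RatFunc M) f₀ → Scheme.IsRegular X₀ →
        ∃ e ≤ E, ∃ (Y : Scheme.{0})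
          (π : Y ⟶ pullback f₀ (Spec.map (CommRingCat.ofHom (iterateFrobenius (RatFunc M) p e)))),
          IsProper π ∧ IsBirational π ∧
            Smooth (π ≫ pullback.snd f₀ (Spec.map (CommRingCat.ofHom (iterateFrobenius (RatFunc M) p e)))) := by
  intro h
  obtain ⟨X₀, f₀, hs, hl, hqc, hd, hint, -, hreg, -, hneg⟩ := frobeniusTwist_exponent_unbounded_regular p M E
  obtain ⟨e, he, Y, π, hP, hB, hS⟩ := h X₀ f₀ hs hl hqc (hd.trans hn) hint hreg
  exact hneg e he Y π hP hB hS

/-- **THE BOUNDED-EXPONENT REGULAR STEP HOLDS IFF ITS HYPOTHESIS FAILS**, in every grade `n ≥ 1`, for every `E`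
and every field `M` of characteristic `p`: «resolution in dimension `≤ n` over `M(t)` ⇒ every regular `X₀` of
dimension `≤ n`, integral over the perfect closure, has a smooth proper birational model of a Frobenius twist of
level `≤ E`» is equivalent to «NO resolution in dimension `≤ n` over `M(t)`». (The unbounded step
`FrobeniusTwistStepRegularAt p M n` is instead implied by `ResolutionInChar p`.) [folklore] -/
theorem boundedFrobeniusTwistStepRegularAt_iff_not_hyp {n : WithBot ℕ∞} (hn : 1 ≤ n) (E : ℕ) :
    ((∀ (X : Scheme.{0}) (f : X ⟶ Spec (.of (RatFunc M))),
        IsSeparated f → LocallyOfFiniteType f → QuasiCompact f → IsIntegral X →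
          topologicalKrullDim X ≤ n → Scheme.HasResolution X) →
      ∀ (X₀ : Scheme.{0}) (f₀ : X₀ ⟶ Spec (.of (RatFunc M))),
        IsSeparated f₀ → LocallyOfFiniteType f₀ → QuasiCompact f₀ → topologicalKrullDim X₀ ≤ n →
          IntegralOverPerfectClosure (RatFunc M) f₀ → Scheme.IsRegular X₀ →
          ∃ e ≤ E, ∃ (Y : Scheme.{0})
            (π : Y ⟶ pullback f₀ (Spec.map (CommRingCat.ofHom (iterateFrobenius (RatFunc M) p e)))),
            IsProper π ∧ IsBirational π ∧
              Smooth (π ≫ pullback.snd f₀ (Spec.map (CommRingCat.ofHom (iterateFrobenius (RatFunc M) p e))))) ↔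
    ¬ ∀ (X : Scheme.{0}) (f : X ⟶ Spec (.of (RatFunc M))),
        IsSeparated f → LocallyOfFiniteType f → QuasiCompact f → IsIntegral X →
          topologicalKrullDim X ≤ n → Scheme.HasResolution X :=
  ⟨fun h hyp => not_boundedExponent_conclusion p M hn E (h hyp), fun h hyp => absurd hyp h⟩

/-- **At grade `n = 1` the bounded-exponent regular step is FALSE for every `E`** (unconditionally: resolution of
curves over `M(t)` is a theorem, `Resolution.hasResolution_of_dim_le_one`), while the unbounded step
`FrobeniusTwistStepRegularAt p M 1` is TRUE (`frobeniusTwistStepRegularAt_of_le_one`, res-L1-s82-pv-1): the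
existential `∃ e` of the residual's normal form is load-bearing and NOT uniform already at the first grade, at
every constant field. [folklore] -/
theorem frobeniusTwistStepRegularAt_one_and_not_bounded (E : ℕ) :
    FrobeniusTwistStepRegularAt p M 1 ∧
    ¬ ((∀ (X : Scheme.{0}) (f : X ⟶ Spec (.of (RatFunc M))),
        IsSeparated f → LocallyOfFiniteType f → QuasiCompact f → IsIntegral X →
          topologicalKrullDim X ≤ 1 → Scheme.HasResolution X) →
      ∀ (X₀ : Scheme.{0}) (f₀ : X₀ ⟶ Spec (.of (RatFunc M))),
        IsSeparated f₀ → LocallyOfFiniteType f₀ → QuasiCompact f₀ → topologicalKrullDim X₀ ≤ 1 →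
          IntegralOverPerfectClosure (RatFunc M) f₀ → Scheme.IsRegular X₀ →
          ∃ e ≤ E, ∃ (Y : Scheme.{0})
            (π : Y ⟶ pullback f₀ (Spec.map (CommRingCat.ofHom (iterateFrobenius (RatFunc M) p e)))),
            IsProper π ∧ IsBirational π ∧
              Smooth (π ≫ pullback.snd f₀ (Spec.map (CommRingCat.ofHom (iterateFrobenius (RatFunc M) p e))))) := by
  refine ⟨frobeniusTwistStepRegularAt_of_le_one p M le_rfl, fun h => ?_⟩
  exact (boundedFrobeniusTwistStepRegularAt_iff_not_hyp p M le_rfl E).mp h fun X f _ _ _ _ hd =>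
    hasResolution_of_dim_le_one X f hd

/-- **For `1 ≤ n ≤ 3` the bounded-exponent regular step is false for every `E`, CONDITIONAL on FACT-LIST F-02**
(`hCP : CossartPiltant2019`, resolution in dimension `≤ 3` over every field). [cite: CossartPiltant2019, Thm. 1.1] -/
theorem not_boundedFrobeniusTwistStepRegularAt_of_le_three (hCP : CossartPiltant2019.{0}) {n : WithBot ℕ∞}
    (h1 : 1 ≤ n) (h3 : n ≤ 3) (E : ℕ) :
    ¬ ((∀ (X : Scheme.{0}) (f : X ⟶ Spec (.of (RatFunc M))),
        IsSeparated f → LocallyOfFiniteType f → QuasiCompact f → IsIntegral X →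
          topologicalKrullDim X ≤ n → Scheme.HasResolution X) →
      ∀ (X₀ : Scheme.{0}) (f₀ : X₀ ⟶ Spec (.of (RatFunc M))),
        IsSeparated f₀ → LocallyOfFiniteType f₀ → QuasiCompact f₀ → topologicalKrullDim X₀ ≤ n →
          IntegralOverPerfectClosure (RatFunc M) f₀ → Scheme.IsRegular X₀ →
          ∃ e ≤ E, ∃ (Y : Scheme.{0})
            (π : Y ⟶ pullback f₀ (Spec.map (CommRingCat.ofHom (iterateFrobenius (RatFunc M) p e)))),
            IsProper π ∧ IsBirational π ∧
              Smooth (π ≫ pullback.snd f₀ (Spec.map (CommRingCat.ofHom (iterateFrobenius (RatFunc M) p e))))) :=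
  fun h => (boundedFrobeniusTwistStepRegularAt_iff_not_hyp p M h1 E).mp h fun X f hs hl hq _ hd =>
    hCP (RatFunc M) X f hs hl hq inferInstance (hd.trans h3)

/-- **At `n = ⊤` the bounded-exponent regular step is EQUIVALENT TO THE FAILURE OF RESOLUTION OVER `M(t)`**
(every `E`) — hence refuted by `ResolutionInChar p` (`not_boundedFrobeniusTwistStepRegularAt_top_of_resolutionInChar`):
the uniform form is anti-implied by the summit, unlike the residual itself. [folklore] -/
theorem boundedFrobeniusTwistStepRegularAt_top_iff (E : ℕ) :
    ((∀ (X : Scheme.{0}) (f : X ⟶ Spec (.of (RatFunc M))),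
        IsSeparated f → LocallyOfFiniteType f → QuasiCompact f → IsIntegral X →
          topologicalKrullDim X ≤ (⊤ : WithBot ℕ∞) → Scheme.HasResolution X) →
      ∀ (X₀ : Scheme.{0}) (f₀ : X₀ ⟶ Spec (.of (RatFunc M))),
        IsSeparated f₀ → LocallyOfFiniteType f₀ → QuasiCompact f₀ → topologicalKrullDim X₀ ≤ (⊤ : WithBot ℕ∞) →
          IntegralOverPerfectClosure (RatFunc M) f₀ → Scheme.IsRegular X₀ →
          ∃ e ≤ E, ∃ (Y : Scheme.{0})
            (π : Y ⟶ pullback f₀ (Spec.map (CommRingCat.ofHom (iterateFrobenius (RatFunc M) p e)))),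
            IsProper π ∧ IsBirational π ∧
              Smooth (π ≫ pullback.snd f₀ (Spec.map (CommRingCat.ofHom (iterateFrobenius (RatFunc M) p e))))) ↔
    ¬ ∀ (X : Scheme.{0}) (f : X ⟶ Spec (.of (RatFunc M))),
        IsSeparated f → LocallyOfFiniteType f → QuasiCompact f → IsIntegral X → Scheme.HasResolution X := by
  rw [boundedFrobeniusTwistStepRegularAt_iff_not_hyp p M le_top E]
  exact not_congr ⟨fun h X f hs hl hq hi => h X f hs hl hq hi le_top,
    fun h X f hs hl hq hi _ => h X f hs hl hq hi⟩

/-- `ResolutionInChar p` refutes the bounded-exponent regular step at `⊤` over every field `M` of characteristic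
`p`, for every `E`. [folklore] -/
theorem not_boundedFrobeniusTwistStepRegularAt_top_of_resolutionInChar (h : ResolutionInChar.{0} p) (E : ℕ) :
    ¬ ((∀ (X : Scheme.{0}) (f : X ⟶ Spec (.of (RatFunc M))),
        IsSeparated f → LocallyOfFiniteType f → QuasiCompact f → IsIntegral X →
          topologicalKrullDim X ≤ (⊤ : WithBot ℕ∞) → Scheme.HasResolution X) →
      ∀ (X₀ : Scheme.{0}) (f₀ : X₀ ⟶ Spec (.of (RatFunc M))),
        IsSeparated f₀ → LocallyOfFiniteType f₀ → QuasiCompact f₀ → topologicalKrullDim X₀ ≤ (⊤ : WithBot ℕ∞) →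
          IntegralOverPerfectClosure (RatFunc M) f₀ → Scheme.IsRegular X₀ →
          ∃ e ≤ E, ∃ (Y : Scheme.{0})
            (π : Y ⟶ pullback f₀ (Spec.map (CommRingCat.ofHom (iterateFrobenius (RatFunc M) p e)))),
            IsProper π ∧ IsBirational π ∧
              Smooth (π ≫ pullback.snd f₀ (Spec.map (CommRingCat.ofHom (iterateFrobenius (RatFunc M) p e))))) :=
  fun hs => (boundedFrobeniusTwistStepRegularAt_top_iff p M E).mp hs fun X f hs' hl hq _ =>
    h (RatFunc M) X f hs' hl hq inferInstance

/-- **Door 2's shape, bounded, is false as well**: for no `E` does the bounded conclusion hold at grade `1` for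
every ALGEBRAICALLY CLOSED field `M` of characteristic `p` (witness `M = (𝔽_p)^{alg}`; door 2's graded residuals —
`CampaignW82.PerfectionStepAlgClosedDimLe`, `…AlgClosureFgDimLe` — quantify over such constant fields).
[folklore] -/
theorem not_forall_isAlgClosed_boundedExponent_conclusion_one (E : ℕ) :
    ¬ ∀ (M : Type) [Field M] [CharP M p] [IsAlgClosed M],
      ∀ (X₀ : Scheme.{0}) (f₀ : X₀ ⟶ Spec (.of (RatFunc M))),
        IsSeparated f₀ → LocallyOfFiniteType f₀ → QuasiCompact f₀ → topologicalKrullDim X₀ ≤ 1 →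
          IntegralOverPerfectClosure (RatFunc M) f₀ → Scheme.IsRegular X₀ →
          ∃ e ≤ E, ∃ (Y : Scheme.{0})
            (π : Y ⟶ pullback f₀ (Spec.map (CommRingCat.ofHom (iterateFrobenius (RatFunc M) p e)))),
            IsProper π ∧ IsBirational π ∧
              Smooth (π ≫ pullback.snd f₀ (Spec.map (CommRingCat.ofHom (iterateFrobenius (RatFunc M) p e)))) :=
  fun h => not_boundedExponent_conclusion p (AlgebraicClosure (ZMod p)) le_rfl E
    (h (AlgebraicClosure (ZMod p)))

end Main

end Summit.ResolutionOfSingularities.ResolutionOfSingularities.Theorems.CampaignW82.TwistExponent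

end
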